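import Literature.MathematicalPhysics.QuantumFieldTheory.Balaban1983to89.B4Thm110RegionLp

/-!
# `Balaban1983to89.B4RegionPairGreen` — [Balaban1983RegularityDecay] THEOREM p. 573, (1.11): THE GREEN's FUNCTIONS OF A
# PAIR `Ω ⊂ Ω₀` ON ONE CARRIER — the operator (1.6) of `Ω₀` with bonds cut across `∂Ω` is the zero-padded direct sum
# `H_k(Ω,A) ⊕ H_k(Ω₀∖Ω,A)`, its Green's function `pad(G_k(Ω,A)) + pad(G_k(Ω₀∖Ω,A))` (`pairGreen`) lives on the sites
# of `Ω₀` next to `G_k(Ω₀,A)`, so that `δG_k(Ω,Ω₀,A) = G_k(Ω,A) − G_k(Ω₀,A)` (1.11) is a difference of two operators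
# on one carrier, as r01 g6's chain `B4Ineq112LpChain.ineq112_value_lp` wants it

statement-level skeleton of published theorems with citation tags; proofs where landed; nothing here is a claim about the Yang–Mills mass gap

WHAT THIS FILE DOES.  §1 two-block padding algebra on a general carrier (`cutWt_not`, `pad_mul_pad_of_disjoint`,
**`covOp_cut_eq_pad_add_pad`**: the operator (1.6) with bond weights cut across `∂S` and no averaging block straddling
`∂S` is `pad_{e₁}(H|_S) + pad_{e₂}(H|_{Sᶜ})` with the pulled-back data, from p17's `covOp_cut_submatrix` and
`covOp_cut_apply_off`; **`padInv2_mul_covOp_cut`** / **`covOp_cut_mul_padInv2`**: `pad_{e₁}(G₁) + pad_{e₂}(G₂)`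
inverts it when `G₁, G₂` invert the two sub-operators).  §2 the region pair: for `Ωc ⊆ Ω₀c` (finite sets of unit
labels) the sub-region `Ω` and its complement `Ω₀ ∖ Ω` embed by `B4RegionCubeCarrier.incl`; the pulled-back data are the
sub-regions' own data ((1.3) bond weights, (1.4) block weights, links, staircase transporters: `regWt_incl`,
`rBlkWt_incl`, `contourTrans_incl`); **`pairGreen`** `= pad_incl(G_k(Ω,A)) + pad_incl(G_k(Ω₀∖Ω,A))`;
**`pairGreen_mul`** / **`covOpCut_mul_pairGreen`** (it inverts `Ω₀`'s operator cut across `∂Ω`, for every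
configuration: `a′ > 0`, `m² ≥ 0`, the sub-region operators are positive definite); **`fld_pairGreen_mulVec_incl`**
(read at a site of `Ω` it is `G_k(Ω,A)` applied to the restriction of `f`).  v1.1: the configuration is an arbitrary bond
function `B` on lattice sites read on each region as `fun u v => B u.1 v.1` (component fields `A`: `B = compField Ac`,
then this is `acBond`; the cube configurations `Ã_j` of (2.2) are of this form too).

HONEST SCOPE.  Finite-dimensional bookkeeping only (no estimate); abelian one-parameter flow, component fields,
staircase contours (the lineage's setting).  No `Prop` fact, no `sorry`; axioms standard.
-/

namespace Literature.MathematicalPhysics.QuantumFieldTheory.Balaban1983to89.B4RegionPairGreen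

open Literature.MathematicalPhysics.QuantumFieldTheory.Balaban1983to89.B4Reflection242 (boxDom mem_boxDom blk)
open Literature.MathematicalPhysics.QuantumFieldTheory.Balaban1983to89.B4GaugeCovariance
open Literature.MathematicalPhysics.QuantumFieldTheory.Balaban1983to89.B4Commutators25to211 (mulH opK mulH_add mulH_one)
open Literature.MathematicalPhysics.QuantumFieldTheory.Balaban1983to89.B4Lower18 (fineDom mem_fineDom IsBlockUnion)
open Literature.MathematicalPhysics.QuantumFieldTheory.Balaban1983to89.B4Lower18RegularRegion (regWt rBlkWt rbaseEmb
  rstairContour regWt_nonneg rBlkWt_ne_zero compField)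
open Literature.MathematicalPhysics.QuantumFieldTheory.Balaban1983to89.B4Eq221L2FactorRegion (acBond)
open Literature.MathematicalPhysics.QuantumFieldTheory.Balaban1983to89.B4CubeOpReindex
open Literature.MathematicalPhysics.QuantumFieldTheory.Balaban1983to89.B4WalkRouteRegion (covOp_blockLocal_posDef)
open Literature.MathematicalPhysics.QuantumFieldTheory.Balaban1983to89.B4RegionCubeCarrier
open Literature.MathematicalPhysics.QuantumFieldTheory.Balaban1983to89.B4LpNormTransfer (pad_mulVec_apply_img
  pad_mulVec_apply_off)
open scoped Matrix

noncomputable section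

/-! ## §1. Two-block padding algebra -/

section TwoBlocks

variable {X X₁ X₂ Y Y₁ Y₂ κ : Type}
variable [Fintype X] [Fintype X₁] [Fintype X₂] [Fintype κ] [DecidableEq X]
variable (S : X → Prop) [DecidablePred S]

omit [Fintype X] [DecidableEq X] in
/-- cutting at `∂S` is cutting at `∂Sᶜ`. [cite: Balaban1983RegularityDecay, (2.6) p.576, dictionary] -/
theorem cutWt_not (c : X → X → ℝ) : cutWt (fun z => ¬ S z) c = cutWt S c := by
  funext z z'
  simp only [cutWt, not_iff_not]

/-- paddings along injections with disjoint images multiply to zero. [cite: Balaban1983RegularityDecay, (2.2) p.575, dictionary] -/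
theorem pad_mul_pad_of_disjoint {e₁ : X₁ → X} {e₂ : X₂ → X} (h : ∀ a b, e₁ a ≠ e₂ b)
    (B : Matrix (X₁ × κ) (X₁ × κ) ℝ) (C : Matrix (X₂ × κ) (X₂ × κ) ℝ) : pad e₁ B * pad e₂ C = 0 := by
  ext p p'
  rw [Matrix.mul_apply, Matrix.zero_apply]
  refine Finset.sum_eq_zero fun p'' _ => ?_
  by_cases hp'' : ∃ b, e₂ b = p''.1
  · obtain ⟨b, hb⟩ := hp''
    rw [pad_apply_of_right e₁ B p (fun a ha => h a b (ha.trans hb.symm)), zero_mul]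
  · rw [pad_apply_of_left e₂ C (fun b hb => hp'' ⟨b, hb⟩), mul_zero]

/-- **`H_cut = pad_{e₁}(H|_S) + pad_{e₂}(H|_{Sᶜ})`**: the operator (1.6) with bond weights cut across `∂S`, no averaging
block straddling `∂S`, is the direct sum of the operators (1.6) OF THE TWO SUB-REGIONS with the restricted data.
[cite: Balaban1983RegularityDecay, (1.6) p.572, (2.6) p.576, (1.11) p.573] -/
theorem covOp_cut_eq_pad_add_pad [Fintype Y] [Fintype Y₁] [Fintype Y₂] [DecidableEq X₁] [DecidableEq X₂]
    [DecidableEq κ] {e₁ : X₁ → X} {e₂ : X₂ → X} {eY₁ : Y₁ → Y} {eY₂ : Y₂ → Y}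
    (he₁ : Function.Injective e₁) (hS₁ : ∀ z, S z ↔ ∃ a, e₁ a = z)
    (he₂ : Function.Injective e₂) (hS₂ : ∀ z, ¬ S z ↔ ∃ b, e₂ b = z)
    (heY₁ : Function.Injective eY₁) (heY₂ : Function.Injective eY₂)
    (c : X → X → ℝ) (m2 a : ℝ) (q : Y → X → ℝ) (W : X → X → Matrix κ κ ℝ) (T : Y → X → Matrix κ κ ℝ)
    (hq₁ : ∀ y a', q y (e₁ a') ≠ 0 → ∃ y', eY₁ y' = y) (hq₂ : ∀ y b, q y (e₂ b) ≠ 0 → ∃ y', eY₂ y' = y)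
    (hSq : ∀ y z z', q y z ≠ 0 → q y z' ≠ 0 → (S z ↔ S z')) :
    covOp (cutWt S c) m2 a q W T
      = pad e₁ (covOp (fun b b' => c (e₁ b) (e₁ b')) m2 a (fun y' b => q (eY₁ y') (e₁ b))
          (fun b b' => W (e₁ b) (e₁ b')) (fun y' b => T (eY₁ y') (e₁ b)))
        + pad e₂ (covOp (fun b b' => c (e₂ b) (e₂ b')) m2 a (fun y' b => q (eY₂ y') (e₂ b))
          (fun b b' => W (e₂ b) (e₂ b')) (fun y' b => T (eY₂ y') (e₂ b))) := by
  have h12 : ∀ a b, e₁ a ≠ e₂ b := fun a b h =>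
    ((hS₂ _).mpr ⟨b, rfl⟩) ((hS₁ _).mpr ⟨a, h⟩)
  ext p p'
  rw [Matrix.add_apply]
  by_cases hp : S p.1
  · obtain ⟨a₁, ha⟩ := (hS₁ _).mp hp
    have hp2 : ∀ b, e₂ b ≠ p.1 := fun b hb => h12 a₁ b (ha.trans hb.symm)
    rw [pad_apply_of_left e₂ _ hp2, add_zero]
    by_cases hp' : S p'.1
    · obtain ⟨a₁', ha'⟩ := (hS₁ _).mp hp'
      obtain ⟨z, k⟩ := p
      obtain ⟨z', k'⟩ := p'
      simp only at ha ha'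
      subst ha; subst ha'
      rw [pad_apply_img he₁]
      have h := congrFun (congrFun (covOp_cut_submatrix S he₁ hS₁ heY₁ c m2 a q W T hq₁) (a₁, k)) (a₁', k')
      simpa only [Matrix.submatrix_apply, Prod.map_apply, id_eq] using h
    · rw [pad_apply_of_right e₁ _ p (fun a'' ha'' => hp' ((hS₁ _).mpr ⟨a'', ha''⟩))]
      obtain ⟨z, k⟩ := p
      obtain ⟨z', k'⟩ := p'
      exact (covOp_cut_apply_off S c m2 a q W T hSq hp' hp k' k).2
  · obtain ⟨b, hb⟩ := (hS₂ _).mp hp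
    have hp1 : ∀ a₁, e₁ a₁ ≠ p.1 := fun a₁ ha => h12 a₁ b (ha.trans hb.symm)
    rw [pad_apply_of_left e₁ _ hp1, zero_add]
    by_cases hp' : S p'.1
    · rw [pad_apply_of_right e₂ _ p (fun b'' hb'' => ((hS₂ _).mpr ⟨b'', hb''⟩) hp')]
      obtain ⟨z, k⟩ := p
      obtain ⟨z', k'⟩ := p'
      exact (covOp_cut_apply_off S c m2 a q W T hSq hp hp' k k').1
    · obtain ⟨b', hb'⟩ := (hS₂ _).mp hp'
      obtain ⟨z, k⟩ := p
      obtain ⟨z', k'⟩ := p'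
      simp only at hb hb'
      subst hb; subst hb'
      rw [pad_apply_img he₂, ← cutWt_not S c]
      have h := congrFun (congrFun (covOp_cut_submatrix (fun z => ¬ S z) he₂ hS₂ heY₂ c m2 a q W T hq₂) (b, k))
        (b', k')
      simpa only [Matrix.submatrix_apply, Prod.map_apply, id_eq] using h

/-- **`(pad_{e₁}(G₁) + pad_{e₂}(G₂))·H_cut = 1`** when `G₁`, `G₂` are left inverses of the two sub-operators: the
direct sum of the Green's functions of the two sub-regions inverts the cut operator.
[cite: Balaban1983RegularityDecay, (1.11) p.573, (2.6) p.576] -/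
theorem padInv2_mul_covOp_cut [Fintype Y] [Fintype Y₁] [Fintype Y₂] [DecidableEq X₁] [DecidableEq X₂]
    [DecidableEq κ] {e₁ : X₁ → X} {e₂ : X₂ → X} {eY₁ : Y₁ → Y} {eY₂ : Y₂ → Y}
    (he₁ : Function.Injective e₁) (hS₁ : ∀ z, S z ↔ ∃ a, e₁ a = z)
    (he₂ : Function.Injective e₂) (hS₂ : ∀ z, ¬ S z ↔ ∃ b, e₂ b = z)
    (heY₁ : Function.Injective eY₁) (heY₂ : Function.Injective eY₂)
    (c : X → X → ℝ) (m2 a : ℝ) (q : Y → X → ℝ) (W : X → X → Matrix κ κ ℝ) (T : Y → X → Matrix κ κ ℝ)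
    (hq₁ : ∀ y a', q y (e₁ a') ≠ 0 → ∃ y', eY₁ y' = y) (hq₂ : ∀ y b, q y (e₂ b) ≠ 0 → ∃ y', eY₂ y' = y)
    (hSq : ∀ y z z', q y z ≠ 0 → q y z' ≠ 0 → (S z ↔ S z'))
    {G₁ : Matrix (X₁ × κ) (X₁ × κ) ℝ} {G₂ : Matrix (X₂ × κ) (X₂ × κ) ℝ}
    (hG₁ : G₁ * covOp (fun b b' => c (e₁ b) (e₁ b')) m2 a (fun y' b => q (eY₁ y') (e₁ b))
      (fun b b' => W (e₁ b) (e₁ b')) (fun y' b => T (eY₁ y') (e₁ b)) = 1)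
    (hG₂ : G₂ * covOp (fun b b' => c (e₂ b) (e₂ b')) m2 a (fun y' b => q (eY₂ y') (e₂ b))
      (fun b b' => W (e₂ b) (e₂ b')) (fun y' b => T (eY₂ y') (e₂ b)) = 1) :
    (pad e₁ G₁ + pad e₂ G₂) * covOp (cutWt S c) m2 a q W T = 1 := by
  have h12 : ∀ a b, e₁ a ≠ e₂ b := fun a b h => ((hS₂ _).mpr ⟨b, rfl⟩) ((hS₁ _).mpr ⟨a, h⟩)
  have h21 : ∀ b a, e₂ b ≠ e₁ a := fun b a h => h12 a b h.symm
  rw [covOp_cut_eq_pad_add_pad S he₁ hS₁ he₂ hS₂ heY₁ heY₂ c m2 a q W T hq₁ hq₂ hSq, Matrix.add_mul,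
    Matrix.mul_add, Matrix.mul_add, pad_mul he₁, pad_mul he₂, hG₁, hG₂, pad_mul_pad_of_disjoint h12,
    pad_mul_pad_of_disjoint h21, add_zero, zero_add, pad_one he₁ S hS₁, pad_one he₂ (fun z => ¬ S z) hS₂,
    ← mulH_add]
  convert mulH_one (X := X) (ι := κ) using 2
  funext z
  simp only [Pi.add_apply]
  split_ifs <;> norm_num

/-- the two-sided version: `H_cut·(pad_{e₁}(G₁) + pad_{e₂}(G₂)) = 1`. [cite: Balaban1983RegularityDecay, (1.11) p.573, (2.6) p.576] -/
theorem covOp_cut_mul_padInv2 [Fintype Y] [Fintype Y₁] [Fintype Y₂] [DecidableEq X₁] [DecidableEq X₂]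
    [DecidableEq κ] {e₁ : X₁ → X} {e₂ : X₂ → X} {eY₁ : Y₁ → Y} {eY₂ : Y₂ → Y}
    (he₁ : Function.Injective e₁) (hS₁ : ∀ z, S z ↔ ∃ a, e₁ a = z)
    (he₂ : Function.Injective e₂) (hS₂ : ∀ z, ¬ S z ↔ ∃ b, e₂ b = z)
    (heY₁ : Function.Injective eY₁) (heY₂ : Function.Injective eY₂)
    (c : X → X → ℝ) (m2 a : ℝ) (q : Y → X → ℝ) (W : X → X → Matrix κ κ ℝ) (T : Y → X → Matrix κ κ ℝ)
    (hq₁ : ∀ y a', q y (e₁ a') ≠ 0 → ∃ y', eY₁ y' = y) (hq₂ : ∀ y b, q y (e₂ b) ≠ 0 → ∃ y', eY₂ y' = y)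
    (hSq : ∀ y z z', q y z ≠ 0 → q y z' ≠ 0 → (S z ↔ S z'))
    {G₁ : Matrix (X₁ × κ) (X₁ × κ) ℝ} {G₂ : Matrix (X₂ × κ) (X₂ × κ) ℝ}
    (hG₁ : G₁ * covOp (fun b b' => c (e₁ b) (e₁ b')) m2 a (fun y' b => q (eY₁ y') (e₁ b))
      (fun b b' => W (e₁ b) (e₁ b')) (fun y' b => T (eY₁ y') (e₁ b)) = 1)
    (hG₂ : G₂ * covOp (fun b b' => c (e₂ b) (e₂ b')) m2 a (fun y' b => q (eY₂ y') (e₂ b))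
      (fun b b' => W (e₂ b) (e₂ b')) (fun y' b => T (eY₂ y') (e₂ b)) = 1) :
    covOp (cutWt S c) m2 a q W T * (pad e₁ G₁ + pad e₂ G₂) = 1 :=
  mul_eq_one_comm.mp
    (padInv2_mul_covOp_cut S he₁ hS₁ he₂ hS₂ heY₁ heY₂ c m2 a q W T hq₁ hq₂ hSq hG₁ hG₂)

end TwoBlocks

/-! ## §2. The pair `Ω ⊂ Ω₀` of finite unions of unit blocks -/

section Pair

variable {d : ℕ} {ι : Type} [Fintype ι] [DecidableEq ι]
variable (F : OrthFlow ι) (κ : ℝ) {n : ℕ} (hn : 1 ≤ n) (Ω₀c Ωc : Finset (Fin (d + 1) → ℤ)) (hsub : Ωc ⊆ Ω₀c)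

omit [Fintype ι] [DecidableEq ι] in
/-- the complement `Ω₀ ∖ Ω` is the image of `incl` from `fineDom n (Ω₀c \ Ωc)`. [cite: Balaban1983RegularityDecay, (1.11) p.573, dictionary] -/
theorem not_inReg_iff (x : ↥(fineDom n Ω₀c)) :
    ¬ inReg n Ωc x ↔ ∃ b, incl hn (Finset.sdiff_subset : Ω₀c \ Ωc ⊆ Ω₀c) b = x := by
  rw [← inReg_iff hn (Finset.sdiff_subset : Ω₀c \ Ωc ⊆ Ω₀c) x]
  unfold inReg
  rw [Finset.mem_sdiff]
  exact ⟨fun h => ⟨(mem_fineDom hn).1 x.2, h⟩, fun h => h.2⟩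

/-- **THE REGION OPERATOR AS `covOp`** (the form the walk route consumes): `H_k(Ω,A)` = (1.6) on the sites of `Ω` with
`Ω`'s bond/block weights, the links `U(κA_b)` and the staircase transporters.
[cite: Balaban1983RegularityDecay, (1.6) p.572] -/
abbrev regOp (m2 a' : ℝ) (B : (Fin (d + 1) → ℤ) → (Fin (d + 1) → ℤ) → ℝ) :
    Matrix (↥(fineDom n Ωc) × ι) (↥(fineDom n Ωc) × ι) ℝ :=
  covOp (regWt n (fineDom n Ωc)) m2 a' (rBlkWt n Ωc (fineDom n Ωc))
    (fieldLink F κ (fun u v : ↥(fineDom n Ωc) => B u.1 v.1))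
    (contourTrans (fieldLink F κ (fun u v : ↥(fineDom n Ωc) => B u.1 v.1)) (rbaseEmb hn Ωc) (rstairContour hn Ωc))

/-- **THE RESTRICTED DATA OF `Ω₀` ALONG `incl` ARE THE SUB-REGION's DATA**: bond weights (1.3), block weights (1.4),
links, staircase transporters. [cite: Balaban1983RegularityDecay, (1.3)–(1.6) p.572, (1.11) p.573] -/
theorem subData_incl {Ωc' : Finset (Fin (d + 1) → ℤ)} (h : Ωc' ⊆ Ω₀c) (m2 a' : ℝ)
    (B : (Fin (d + 1) → ℤ) → (Fin (d + 1) → ℤ) → ℝ) :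
    covOp (fun b b' => regWt n (fineDom n Ω₀c) (incl hn h b) (incl hn h b')) m2 a'
        (fun y' b => rBlkWt n Ω₀c (fineDom n Ω₀c) (inclY h y') (incl hn h b))
        (fun b b' => fieldLink F κ (fun u v : ↥(fineDom n Ω₀c) => B u.1 v.1) (incl hn h b) (incl hn h b'))
        (fun y' b => contourTrans (fieldLink F κ (fun u v : ↥(fineDom n Ω₀c) => B u.1 v.1)) (rbaseEmb hn Ω₀c)
          (rstairContour hn Ω₀c) (inclY h y') (incl hn h b))
      = regOp F κ hn Ωc' m2 a' B := by
  have hT : (fun y' b => contourTrans (fieldLink F κ (fun u v : ↥(fineDom n Ω₀c) => B u.1 v.1)) (rbaseEmb hn Ω₀c)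
      (rstairContour hn Ω₀c) (inclY h y') (incl hn h b))
      = contourTrans (fieldLink F κ (fun u v : ↥(fineDom n Ωc') => B u.1 v.1)) (rbaseEmb hn Ωc')
          (rstairContour hn Ωc') := by
    funext y' b
    exact contourTrans_incl hn h F κ (fun u v : ↥(fineDom n Ω₀c) => B u.1 v.1) y' b
  rw [hT]
  rfl

/-- **`G⊕ = pad_incl(G_k(Ω,A)) + pad_incl(G_k(Ω₀∖Ω,A))`** on the sites of `Ω₀`: the Green's function of `Ω₀`'s operator
cut across `∂Ω`; read on `Ω` it is `G_k(Ω,A)` ((1.11)'s first term). [cite: Balaban1983RegularityDecay, (1.11) p.573, (2.2) p.575] -/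
def pairGreen (m2 a' : ℝ) (B : (Fin (d + 1) → ℤ) → (Fin (d + 1) → ℤ) → ℝ) :
    Matrix (↥(fineDom n Ω₀c) × ι) (↥(fineDom n Ω₀c) × ι) ℝ :=
  pad (incl hn hsub) (regOp F κ hn Ωc m2 a' B)⁻¹
    + pad (incl hn (Finset.sdiff_subset : Ω₀c \ Ωc ⊆ Ω₀c)) (regOp F κ hn (Ω₀c \ Ωc) m2 a' B)⁻¹

/-- **`G⊕ · H_cut = 1`** for EVERY configuration (`a′ > 0`, `m² ≥ 0`: the two sub-region operators are positive
definite). [cite: Balaban1983RegularityDecay, (1.11) p.573, (1.6) p.572] -/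
theorem pairGreen_mul {m2 a' : ℝ} (ha' : 0 < a') (hm : 0 ≤ m2) (B : (Fin (d + 1) → ℤ) → (Fin (d + 1) → ℤ) → ℝ) :
    pairGreen F κ hn Ω₀c Ωc hsub m2 a' B
      * covOp (cutWt (inReg n Ωc) (regWt n (fineDom n Ω₀c))) m2 a' (rBlkWt n Ω₀c (fineDom n Ω₀c))
          (fieldLink F κ (fun u v : ↥(fineDom n Ω₀c) => B u.1 v.1))
          (contourTrans (fieldLink F κ (fun u v : ↥(fineDom n Ω₀c) => B u.1 v.1)) (rbaseEmb hn Ω₀c)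
            (rstairContour hn Ω₀c)) = 1 := by
  have hinv : ∀ {Ωc' : Finset (Fin (d + 1) → ℤ)}, (regOp F κ hn Ωc' m2 a' B)⁻¹ * regOp F κ hn Ωc' m2 a' B = 1 := by
    intro Ωc'
    have hpd := covOp_blockLocal_posDef hn Ωc' F κ ha' hm (regWt n (fineDom n Ωc')) (regWt_nonneg _ _)
      (fun _ _ _ => rfl) (fun u v : ↥(fineDom n Ωc') => B u.1 v.1)
    exact Matrix.nonsing_inv_mul _ ((Matrix.isUnit_iff_isUnit_det _).mp hpd.isUnit)
  refine padInv2_mul_covOp_cut (inReg n Ωc) (incl_injective hn hsub) (inReg_iff hn hsub)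
    (incl_injective hn _) (not_inReg_iff hn Ω₀c Ωc) (inclY_injective hsub) (inclY_injective _) _ m2 a' _ _ _
    (fun y b h => rBlkWt_incl_ne_zero hn hsub h) (fun y b h => rBlkWt_incl_ne_zero hn _ h)
    (fun y z z' h h' => inReg_iff_of_rBlkWt h h') ?_ ?_
  · rw [subData_incl]; exact hinv
  · rw [subData_incl]; exact hinv

/-- the two-sided version `H_cut · G⊕ = 1`. [cite: Balaban1983RegularityDecay, (1.11) p.573] -/
theorem covOpCut_mul_pairGreen {m2 a' : ℝ} (ha' : 0 < a') (hm : 0 ≤ m2)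
    (B : (Fin (d + 1) → ℤ) → (Fin (d + 1) → ℤ) → ℝ) :
    covOp (cutWt (inReg n Ωc) (regWt n (fineDom n Ω₀c))) m2 a' (rBlkWt n Ω₀c (fineDom n Ω₀c))
        (fieldLink F κ (fun u v : ↥(fineDom n Ω₀c) => B u.1 v.1))
        (contourTrans (fieldLink F κ (fun u v : ↥(fineDom n Ω₀c) => B u.1 v.1)) (rbaseEmb hn Ω₀c)
          (rstairContour hn Ω₀c))
      * pairGreen F κ hn Ω₀c Ωc hsub m2 a' B = 1 :=
  mul_eq_one_comm.mp (pairGreen_mul F κ hn Ω₀c Ωc hsub ha' hm B)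

/-- **READ ON `Ω`, `G⊕f` IS `G_k(Ω,A)(f|_Ω)`**: `(G⊕f)(incl a) = (G_k(Ω,A)(f∘incl))(a)`.
[cite: Balaban1983RegularityDecay, (1.11) p.573] -/
theorem pairGreen_mulVec_incl (m2 a' : ℝ) (B : (Fin (d + 1) → ℤ) → (Fin (d + 1) → ℤ) → ℝ)
    (f : ↥(fineDom n Ω₀c) × ι → ℝ) (a : ↥(fineDom n Ωc)) (i : ι) :
    (pairGreen F κ hn Ω₀c Ωc hsub m2 a' B *ᵥ f) (incl hn hsub a, i)
      = ((regOp F κ hn Ωc m2 a' B)⁻¹ *ᵥ fun q : ↥(fineDom n Ωc) × ι => f (incl hn hsub q.1, q.2)) (a, i) := by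
  rw [pairGreen, Matrix.add_mulVec, Pi.add_apply, pad_mulVec_apply_img (incl_injective hn hsub)]
  have h0 : (pad (incl hn (Finset.sdiff_subset : Ω₀c \ Ωc ⊆ Ω₀c)) (regOp F κ hn (Ω₀c \ Ωc) m2 a' B)⁻¹ *ᵥ f)
      (incl hn hsub a, i) = 0 := by
    simp only [Matrix.mulVec, dotProduct]
    refine Finset.sum_eq_zero fun p _ => ?_
    rw [pad_apply_of_left _ _ (fun b hb => ?_), zero_mul]
    have h1 : ¬ inReg n Ωc (incl hn hsub a) := (not_inReg_iff hn Ω₀c Ωc _).mpr ⟨b, hb⟩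
    exact h1 ((inReg_iff hn hsub _).mpr ⟨a, rfl⟩)
  rw [h0, add_zero]

/-- for a component field `A`, `regOp … (compField Ac)` is the region operator in the lineage's `acBond` spelling
(`B4WalkRouteRegion.green_mul_op`'s operator; `B4Lemma21Region.regionOp` at `κ = e/n`, `a′ = a_kη^{d+1}`). [cite: Balaban1983RegularityDecay, (1.6) p.572] -/
theorem regOp_compField (m2 a' : ℝ) (Ac : (Fin (d + 1) → ℤ) → Fin (d + 1) → ℝ) :
    regOp F κ hn Ωc m2 a' (compField Ac)
      = covOp (regWt n (fineDom n Ωc)) m2 a' (rBlkWt n Ωc (fineDom n Ωc)) (fieldLink F κ (acBond Ωc Ac))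
          (contourTrans (fieldLink F κ (acBond Ωc Ac)) (rbaseEmb hn Ωc) (rstairContour hn Ωc)) := rfl

end Pair

end

end Literature.MathematicalPhysics.QuantumFieldTheory.Balaban1983to89.B4RegionPairGreen
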